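import Mathlib
import Summits.NavierStokesRegularity.NavierStokesRegularity.Theorems.EulerZoomLiouvillePowerGaugeEulerLiouvillePastFrameSteadyTools
import Summits.NavierStokesRegularity.NavierStokesRegularity.Theorems.EulerZoomLiouvillePowerGaugeEulerLiouvilleGalileanHarmonicShear
import Literature.Analysis.FluidPDE.SpaceTimeRescaling
import HarnessLib

/-!
# Crux E `PowerGaugeEulerLiouville` (stmt-NavierStokesRegularity-19832), line `galilean-frames` (ns-idea-11 g6/g7), stub F3
# `stub_wanderingReduce` — tools IV: THE A-GAUGE IN A WANDERING SIMILARITY FRAME; LINE-INVARIANT FIELDS OF SUB-LINEAR GROWTH VANISH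
# (width seat ns-ezl-w3 g5)

Route №10 `EulerZoomLiouville` (NavierStokesRegularity), crux E.  For a WANDERING self-similar member with background,
`u(τ, y) = (T−τ)^{γ−1} V((T−τ)^{−γ}(y − ξ(τ))) + η(τ)` (`τ < T₁ ≤ 0`, `T₁ ≤ T`, `γ = 1/(2+ρ)`, `0 < ρ ≤ 1/2`):

* `wandering_profile_growth` — the SLICE A-gauge `∫_{B_a}|u(τ)|² ≤ c a^{1−2ρ}` read in the similarity frame of the slice `τ`:
  `∫_{B_L} |V + (T−τ)^{1−γ}η(τ)|² ≤ C_τ L^{1−2ρ}` for `L ≥ 1` (lever (L1) of the line, scale-invariant form);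
* `wandering_background_const` — hence `(T−τ)^{1−γ} η(τ)` is CONSTANT on the window (two slices: the difference is a constant field of
  growth exponent `1 − 2ρ < 3`) — the background of a wandering member is slaved to the similarity clock;
* `ae_eq_zero_of_translationInvariant_of_growth` — a field on `ℝ³` invariant (a.e.) under all translations along a direction `e ≠ 0`
  with `∫_{B_R}|U|² ≤ C R^θ` (`R ≥ 1`, `θ < 1`) vanishes a.e. (`N` disjoint translated balls inside `B_{(2N+1)R}`).

WHAT THIS IS NOT: not NS regularity, not the crux E — tools for one stratum of the crux CLASS 19832 (MODEL lattice; E/NS strata),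
`--supports` stmt-19832; 19832 OPEN. [folklore]
-/

noncomputable section

-- flat `Theorems/<Route><Decl>…` files of one crux share the namespace of the crux (tree convention: `Summit.<S>.<S>.…`)
set_option linter.dupNamespace false

open MeasureTheory Set Filter Topology Metric Function TopologicalSpace InnerProductSpace
open scoped ENNReal NNReal RealInnerProductSpace

namespace Summit.NavierStokesRegularity.NavierStokesRegularity.Theorems.PowerGaugeEulerLiouville

namespace GalileanFrames

open Literature.Analysis Literature.Analysis.FunctionSpaces Literature.Analysis.FluidPDE
open Summit.NavierStokesRegularity.NavierStokesRegularity.Theorems.PowerGaugeEulerLiouville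

variable {u : ℝ → EuclideanSpace ℝ (Fin 3) → EuclideanSpace ℝ (Fin 3)}
  {V : EuclideanSpace ℝ (Fin 3) → EuclideanSpace ℝ (Fin 3)} {ξ η : ℝ → EuclideanSpace ℝ (Fin 3)} {T T₁ : ℝ}

/-! ### The slice A-gauge in the similarity frame -/

/-- **THE A-GAUGE OF A WANDERING SLICE IN ITS SIMILARITY FRAME.**  If `u(τ) = (T−τ)^{γ−1}V((T−τ)^{−γ}(· − ξ(τ))) + η(τ)` at ONE time
`τ < T₁ ≤ min(0,T)` (`γ = 1/(2+ρ)`, `0 < ρ ≤ 1/2`) and the A-gauge `a^{2ρ}A(a) ≤ c` holds at the origin, then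
`∫_{B_L} |V(Y) + (T−τ)^{1−γ}η(τ)|² dY ≤ C L^{1−2ρ}` for all `L ≥ 1`, with a finite constant `C`. [folklore] -/
theorem wandering_profile_growth {ρ : ℝ} (hρ : 0 < ρ) (hρ2 : ρ ≤ 1 / 2) {c : ℝ≥0}
    (hA : ∀ a : ℝ, 0 < a → ENNReal.ofReal (a ^ (2 * ρ)) * cknA a (0 : ℝ × EuclideanSpace ℝ (Fin 3)) u ≤ (c : ℝ≥0∞))
    (hT₁ : T₁ ≤ 0) (hT : T₁ ≤ T) {τ : ℝ} (hτ : τ < T₁)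
    (huτ : u τ = fun y => (T - τ) ^ (1 / (2 + ρ) - 1) • V ((T - τ) ^ (-(1 / (2 + ρ))) • (y - ξ τ)) + η τ) :
    ∃ C : ℝ≥0∞, C ≠ ⊤ ∧ ∀ L : ℝ, 1 ≤ L →
      ∫⁻ Y in ball (0 : EuclideanSpace ℝ (Fin 3)) L, ‖V Y + (T - τ) ^ (1 - 1 / (2 + ρ)) • η τ‖ₑ ^ 2 ≤
        C * ENNReal.ofReal (L ^ (1 - 2 * ρ)) := by
  set γ : ℝ := 1 / (2 + ρ) with hγdef
  have hl : 0 < T - τ := by linarith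
  set s : ℝ := (T - τ) ^ γ with hsdef
  have hs : 0 < s := Real.rpow_pos_of_pos hl _
  set κ : EuclideanSpace ℝ (Fin 3) := (T - τ) ^ (1 - γ) • η τ with hκ
  -- the slice in the similarity frame
  have hslice : ∀ y, V (s⁻¹ • (y - ξ τ)) + κ = (T - τ) ^ (1 - γ) • u τ y := by
    intro y
    rw [huτ]
    simp only [hκ, smul_add, smul_smul]
    rw [← Real.rpow_add hl, show (1 - γ + (γ - 1) : ℝ) = 0 by ring, Real.rpow_zero, one_smul, Real.rpow_neg hl.le]
  -- constants
  set K : ℝ := s + ‖ξ τ‖ + |τ| + 1 with hK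
  have hK1 : 1 ≤ K := by rw [hK]; linarith [norm_nonneg (ξ τ), abs_nonneg τ, hs.le]
  have hK0 : 0 < K := by linarith
  set C : ℝ≥0∞ := ENNReal.ofReal ((s ^ 3)⁻¹) * ENNReal.ofReal ((T - τ) ^ (2 * (1 - γ))) *
    ENNReal.ofReal ((c : ℝ) * K ^ (1 - 2 * ρ)) with hC
  refine ⟨C, ?_, fun L hL => ?_⟩
  · exact ENNReal.mul_ne_top (ENNReal.mul_ne_top ENNReal.ofReal_ne_top ENNReal.ofReal_ne_top) ENNReal.ofReal_ne_top
  -- the scale `a` of the A-gauge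
  set a : ℝ := s * L + ‖ξ τ‖ + (|τ| + 1) with ha
  have hL0 : 0 < L := by linarith
  have ha1 : |τ| + 1 ≤ a := by rw [ha]; nlinarith [norm_nonneg (ξ τ), hs.le, hL0.le]
  have ha0 : 0 < a := by linarith [abs_nonneg τ]
  have hτI : τ ∈ Ioo (-(a ^ 2)) 0 := by
    refine ⟨?_, lt_of_lt_of_le hτ hT₁⟩
    have : |τ| < a ^ 2 := by nlinarith [abs_nonneg τ]
    linarith [neg_abs_le τ]
  have hAs := Backward.lintegral_ball_le_of_gaugeA ha0 (hA a ha0) hτI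
  -- `B_L ⊆` the preimage of `B_a` under the frame map
  have hsub : ball (0 : EuclideanSpace ℝ (Fin 3)) L ⊆ (fun Y : EuclideanSpace ℝ (Fin 3) => ξ τ + s • Y) ⁻¹' ball 0 a := by
    intro Y hY
    rw [mem_ball, dist_zero_right] at hY
    rw [mem_preimage, mem_ball, dist_zero_right]
    calc ‖ξ τ + s • Y‖ ≤ ‖ξ τ‖ + ‖s • Y‖ := norm_add_le _ _
      _ = ‖ξ τ‖ + s * ‖Y‖ := by rw [norm_smul, Real.norm_of_nonneg hs.le]
      _ < a := by rw [ha]; nlinarith [abs_nonneg τ]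
  -- change of variables
  have hcv' : ∫⁻ Y in (fun Y : EuclideanSpace ℝ (Fin 3) => ξ τ + s • Y) ⁻¹' ball 0 a, ‖V Y + κ‖ₑ ^ 2 =
      ENNReal.ofReal ((s ^ 3)⁻¹) * ∫⁻ y in ball (0 : EuclideanSpace ℝ (Fin 3)) a, ‖V (s⁻¹ • (y - ξ τ)) + κ‖ₑ ^ 2 := by
    have h := setLIntegral_preimage_comp_space_affine hs (ξ τ) (fun y => ‖V (s⁻¹ • (y - ξ τ)) + κ‖ₑ ^ 2) (ball 0 a)
    rw [finrank_euclideanSpace_fin] at h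
    simp only [add_sub_cancel_left, smul_smul, inv_mul_cancel₀ hs.ne', one_smul] at h
    exact h
  -- the integrand in terms of `u τ`
  have hsq : ((T - τ) ^ (1 - γ)) ^ 2 = (T - τ) ^ (2 * (1 - γ)) := by
    rw [← Real.rpow_natCast, ← Real.rpow_mul hl.le]; ring_nf
  have hint : ∫⁻ y in ball (0 : EuclideanSpace ℝ (Fin 3)) a, ‖V (s⁻¹ • (y - ξ τ)) + κ‖ₑ ^ 2 =
      ENNReal.ofReal ((T - τ) ^ (2 * (1 - γ))) * ∫⁻ y in ball (0 : EuclideanSpace ℝ (Fin 3)) a, ‖u τ y‖ₑ ^ 2 := by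
    rw [← lintegral_const_mul' _ _ ENNReal.ofReal_ne_top]
    refine lintegral_congr_ae (Eventually.of_forall fun y => ?_)
    show ‖V (s⁻¹ • (y - ξ τ)) + κ‖ₑ ^ 2 = ENNReal.ofReal ((T - τ) ^ (2 * (1 - γ))) * ‖u τ y‖ₑ ^ 2
    rw [hslice y, enorm_smul, mul_pow, Real.enorm_eq_ofReal (Real.rpow_nonneg hl.le _),
      ← ENNReal.ofReal_pow (Real.rpow_nonneg hl.le _), hsq]
  -- assemble
  have hKL : a ≤ K * L := by
    rw [ha, hK]
    nlinarith [norm_nonneg (ξ τ), abs_nonneg τ, hs.le]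
  have hpow : a ^ (1 - 2 * ρ) ≤ K ^ (1 - 2 * ρ) * L ^ (1 - 2 * ρ) := by
    rw [← Real.mul_rpow hK0.le hL0.le]
    exact Real.rpow_le_rpow ha0.le hKL (by linarith)
  calc ∫⁻ Y in ball (0 : EuclideanSpace ℝ (Fin 3)) L, ‖V Y + κ‖ₑ ^ 2
      ≤ ∫⁻ Y in (fun Y : EuclideanSpace ℝ (Fin 3) => ξ τ + s • Y) ⁻¹' ball 0 a, ‖V Y + κ‖ₑ ^ 2 := lintegral_mono_set hsub
    _ = ENNReal.ofReal ((s ^ 3)⁻¹) * (ENNReal.ofReal ((T - τ) ^ (2 * (1 - γ))) *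
          ∫⁻ y in ball (0 : EuclideanSpace ℝ (Fin 3)) a, ‖u τ y‖ₑ ^ 2) := by rw [hcv', hint]
    _ ≤ ENNReal.ofReal ((s ^ 3)⁻¹) * (ENNReal.ofReal ((T - τ) ^ (2 * (1 - γ))) * ENNReal.ofReal ((c : ℝ) * a ^ (1 - 2 * ρ))) := by
        gcongr
    _ ≤ ENNReal.ofReal ((s ^ 3)⁻¹) * (ENNReal.ofReal ((T - τ) ^ (2 * (1 - γ))) *
          (ENNReal.ofReal ((c : ℝ) * K ^ (1 - 2 * ρ)) * ENNReal.ofReal (L ^ (1 - 2 * ρ)))) := by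
        gcongr
        rw [← ENNReal.ofReal_mul (by positivity)]
        exact ENNReal.ofReal_le_ofReal (by rw [mul_assoc]; exact mul_le_mul_of_nonneg_left hpow c.coe_nonneg)
    _ = C * ENNReal.ofReal (L ^ (1 - 2 * ρ)) := by rw [hC]; ring

/-- **THE BACKGROUND OF A WANDERING MEMBER IS SLAVED TO THE SIMILARITY CLOCK**: `(T−τ)^{1−γ} η(τ)` is constant on the window
(two slices: the difference of the two frame constants is a constant field with `∫_{B_L}|·|² ≲ L^{1−2ρ}`, `1 − 2ρ < 3`). [folklore] -/
theorem wandering_background_const {ρ : ℝ} (hρ : 0 < ρ) (hρ2 : ρ ≤ 1 / 2) {c : ℝ≥0}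
    (hA : ∀ a : ℝ, 0 < a → ENNReal.ofReal (a ^ (2 * ρ)) * cknA a (0 : ℝ × EuclideanSpace ℝ (Fin 3)) u ≤ (c : ℝ≥0∞))
    (hT₁ : T₁ ≤ 0) (hT : T₁ ≤ T) (hVm : AEStronglyMeasurable V volume)
    (hu : ∀ τ : ℝ, τ < T₁ → u τ = fun y => (T - τ) ^ (1 / (2 + ρ) - 1) • V ((T - τ) ^ (-(1 / (2 + ρ))) • (y - ξ τ)) + η τ)
    {τ₁ τ₂ : ℝ} (hτ₁ : τ₁ < T₁) (hτ₂ : τ₂ < T₁) :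
    (T - τ₁) ^ (1 - 1 / (2 + ρ)) • η τ₁ = (T - τ₂) ^ (1 - 1 / (2 + ρ)) • η τ₂ := by
  obtain ⟨C₁, hC₁, hg₁⟩ := wandering_profile_growth hρ hρ2 hA hT₁ hT hτ₁ (hu τ₁ hτ₁)
  obtain ⟨C₂, hC₂, hg₂⟩ := wandering_profile_growth hρ hρ2 hA hT₁ hT hτ₂ (hu τ₂ hτ₂)
  set κ₁ : EuclideanSpace ℝ (Fin 3) := (T - τ₁) ^ (1 - 1 / (2 + ρ)) • η τ₁ with hκ₁
  set κ₂ : EuclideanSpace ℝ (Fin 3) := (T - τ₂) ^ (1 - 1 / (2 + ρ)) • η τ₂ with hκ₂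
  set w : EuclideanSpace ℝ (Fin 3) := κ₁ - κ₂ with hw
  have hwY : ∀ Y, w = (V Y + κ₁) - (V Y + κ₂) := fun Y => by rw [hw]; abel
  have hm₁ : AEStronglyMeasurable (fun Y => V Y + κ₁) volume := hVm.add aestronglyMeasurable_const
  have hm₂ : AEStronglyMeasurable (fun Y => V Y + κ₂) volume := hVm.add aestronglyMeasurable_const
  have hgrow : ∀ L : ℝ, 1 ≤ L → ∫⁻ Y in ball (0 : EuclideanSpace ℝ (Fin 3)) L, ‖(fun _ : EuclideanSpace ℝ (Fin 3) => w) Y‖ₑ ^ 2 ≤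
      (2 * C₁ + 2 * C₂) * ENNReal.ofReal (L ^ (1 - 2 * ρ)) := by
    intro L hL
    calc ∫⁻ Y in ball (0 : EuclideanSpace ℝ (Fin 3)) L, ‖(fun _ : EuclideanSpace ℝ (Fin 3) => w) Y‖ₑ ^ 2
        = ∫⁻ Y in ball (0 : EuclideanSpace ℝ (Fin 3)) L, ‖(V Y + κ₁) - (V Y + κ₂)‖ₑ ^ 2 :=
          lintegral_congr_ae (Eventually.of_forall fun Y => by simp only [← hwY Y])
      _ ≤ ∫⁻ Y in ball (0 : EuclideanSpace ℝ (Fin 3)) L, (2 * ‖V Y + κ₁‖ₑ ^ 2 + 2 * ‖V Y + κ₂‖ₑ ^ 2) :=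
          lintegral_mono fun Y => TypeITraceScarL3.enorm_sub_sq_le _ _
      _ = 2 * (∫⁻ Y in ball (0 : EuclideanSpace ℝ (Fin 3)) L, ‖V Y + κ₁‖ₑ ^ 2) +
            2 * ∫⁻ Y in ball (0 : EuclideanSpace ℝ (Fin 3)) L, ‖V Y + κ₂‖ₑ ^ 2 := by
          rw [lintegral_add_left' ((hm₁.restrict.enorm.pow_const 2).const_mul 2), lintegral_const_mul'' _ (hm₁.restrict.enorm.pow_const 2),
            lintegral_const_mul'' _ (hm₂.restrict.enorm.pow_const 2)]
      _ ≤ 2 * (C₁ * ENNReal.ofReal (L ^ (1 - 2 * ρ))) + 2 * (C₂ * ENNReal.ofReal (L ^ (1 - 2 * ρ))) := by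
          gcongr
          · exact hg₁ L hL
          · exact hg₂ L hL
      _ = (2 * C₁ + 2 * C₂) * ENNReal.ofReal (L ^ (1 - 2 * ρ)) := by ring
  obtain ⟨C', hC', hCgrow⟩ := Shifted.growth_of_growth_le (V := fun _ : EuclideanSpace ℝ (Fin 3) => w) continuous_const
    (by linarith : 1 - 2 * ρ ≤ 3) le_rfl
    (by
      refine ENNReal.add_ne_top.2 ⟨ENNReal.mul_ne_top ENNReal.ofNat_ne_top hC₁, ENNReal.mul_ne_top ENNReal.ofNat_ne_top hC₂⟩)
    hgrow
  have hw0 : w = 0 := NoDrift.eq_zero_of_const_of_lintegral_ball_le hC' (by linarith) hCgrow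
  rw [hw] at hw0
  exact sub_eq_zero.1 hw0

/-! ### Line-invariant fields of sub-linear `L²`-growth vanish -/

/-- **A TRANSLATION-INVARIANT FIELD OF SUB-LINEAR `L²`-GROWTH VANISHES.**  If `U(· + s e) = U` a.e. for every `s` (`e ≠ 0`) and
`∫_{B_R} |U|² ≤ C R^θ` for `R ≥ 1` with `0 ≤ θ < 1` and `C < ∞`, then `U = 0` a.e.: `N` pairwise disjoint translates of `B_R` along `e`
fit in `B_{(2N+1)R}` and all carry the same mass `m(R)`, so `N·m(R) ≤ C (2N+1)^θ R^θ` for every `N`. [folklore] -/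
theorem ae_eq_zero_of_translationInvariant_of_growth {U : EuclideanSpace ℝ (Fin 3) → EuclideanSpace ℝ (Fin 3)}
    (hUm : AEStronglyMeasurable U volume) {e : EuclideanSpace ℝ (Fin 3)} (he : e ≠ 0)
    (hinv : ∀ s : ℝ, (fun z => U (z + s • e)) =ᵐ[volume] U) {C : ℝ≥0∞} (hC : C ≠ ⊤) {θ : ℝ} (hθ : θ < 1) (hθ0 : 0 ≤ θ)
    (hgrow : ∀ R : ℝ, 1 ≤ R → ∫⁻ z in ball (0 : EuclideanSpace ℝ (Fin 3)) R, ‖U z‖ₑ ^ 2 ≤ C * ENNReal.ofReal (R ^ θ)) :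
    U =ᵐ[volume] 0 := by
  have he0 : 0 < ‖e‖ := norm_pos_iff.2 he
  -- the mass of a ball of radius `R ≥ 1` vanishes
  have hmass : ∀ R : ℝ, 1 ≤ R → ∫⁻ z in ball (0 : EuclideanSpace ℝ (Fin 3)) R, ‖U z‖ₑ ^ 2 = 0 := by
    intro R hR
    have hR0 : 0 < R := by linarith
    set m : ℝ≥0∞ := ∫⁻ z in ball (0 : EuclideanSpace ℝ (Fin 3)) R, ‖U z‖ₑ ^ 2 with hm
    -- translates: centres `x k = (2 R k / ‖e‖) • e`
    set x : ℕ → EuclideanSpace ℝ (Fin 3) := fun k => ((2 * R * k) / ‖e‖) • e with hx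
    have hxnorm : ∀ k : ℕ, ‖x k‖ = 2 * R * k := fun k => by
      simp only [hx]
      rw [norm_smul, Real.norm_of_nonneg (by positivity), div_mul_cancel₀ _ he0.ne']
    have hdist : ∀ j k : ℕ, j ≠ k → 2 * R ≤ dist (x j) (x k) := by
      intro j k hjk
      have h1 : (1 : ℝ) ≤ |(j : ℝ) - (k : ℝ)| := by
        rcases lt_or_gt_of_ne hjk with h | h
        · have h' : (j : ℝ) + 1 ≤ k := by exact_mod_cast h
          rw [abs_sub_comm, abs_of_nonneg (by linarith)]; linarith
        · have h' : (k : ℝ) + 1 ≤ j := by exact_mod_cast h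
          rw [abs_of_nonneg (by linarith)]; linarith
      rw [dist_eq_norm]
      simp only [hx]
      rw [← sub_smul, norm_smul, ← sub_div, Real.norm_eq_abs, abs_div, abs_of_pos he0, div_mul_cancel₀ _ he0.ne',
        ← mul_sub, abs_mul, abs_of_pos (by linarith : (0 : ℝ) < 2 * R)]
      nlinarith
    -- each translate carries the mass `m`
    have htrans : ∀ k : ℕ, ∫⁻ z in ball (x k) R, ‖U z‖ₑ ^ 2 = m := by
      intro k
      rw [← setLIntegral_ball_comp_add_right (fun z => ‖U z‖ₑ ^ 2) (x k) R, hm]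
      refine lintegral_congr_ae (ae_restrict_of_ae ?_)
      filter_upwards [hinv ((2 * R * k) / ‖e‖)] with z hz
      simp only [hx] at hz ⊢
      rw [hz]
    -- `N` disjoint translates inside `B_{(2N+1)R}`
    have hcount : ∀ N : ℕ, (N : ℝ≥0∞) * m ≤ C * ENNReal.ofReal (((2 * N + 1) * R) ^ θ) := by
      intro N
      have hdisj : (↑(Finset.range N) : Set ℕ).PairwiseDisjoint fun k => ball (x k) R := by
        intro j _ k _ hjk
        exact ball_disjoint_ball (by linarith [hdist j k hjk])
      have hU : ⋃ k ∈ Finset.range N, ball (x k) R ⊆ ball (0 : EuclideanSpace ℝ (Fin 3)) ((2 * N + 1) * R) := by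
        intro z hz
        simp only [mem_iUnion, Finset.mem_range, exists_prop] at hz
        obtain ⟨k, hk, hzk⟩ := hz
        rw [mem_ball, dist_zero_right]
        rw [mem_ball, dist_eq_norm] at hzk
        have hk' : (k : ℝ) ≤ N - 1 := by
          have : k + 1 ≤ N := hk
          have : ((k : ℕ) : ℝ) + 1 ≤ N := by exact_mod_cast this
          linarith
        calc ‖z‖ ≤ ‖z - x k‖ + ‖x k‖ := norm_le_norm_sub_add z (x k)
          _ < R + 2 * R * k := by rw [hxnorm k]; linarith
          _ ≤ (2 * N + 1) * R := by nlinarith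
      calc (N : ℝ≥0∞) * m = ∑ k ∈ Finset.range N, ∫⁻ z in ball (x k) R, ‖U z‖ₑ ^ 2 := by
            simp only [htrans, Finset.sum_const, Finset.card_range, nsmul_eq_mul]
        _ = ∫⁻ z in ⋃ k ∈ Finset.range N, ball (x k) R, ‖U z‖ₑ ^ 2 :=
            (lintegral_biUnion_finset hdisj (fun k _ => measurableSet_ball) _).symm
        _ ≤ ∫⁻ z in ball (0 : EuclideanSpace ℝ (Fin 3)) ((2 * N + 1) * R), ‖U z‖ₑ ^ 2 := lintegral_mono_set hU
        _ ≤ C * ENNReal.ofReal (((2 * N + 1) * R) ^ θ) := hgrow _ (by nlinarith [N.cast_nonneg (α := ℝ)])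
    -- pass to real numbers: `N · m ≤ C (3R)^θ N^θ`, `θ < 1`, forces `m = 0`
    have hmtop : m ≠ ⊤ := by
      have h := hgrow R hR
      exact ne_top_of_le_ne_top (ENNReal.mul_ne_top hC ENNReal.ofReal_ne_top) h
    by_contra hm0
    have hmr : 0 < m.toReal := ENNReal.toReal_pos hm0 hmtop
    set Cr : ℝ := C.toReal * (3 * R) ^ θ with hCr
    have hCr0 : 0 ≤ Cr := by rw [hCr]; positivity
    have hreal : ∀ N : ℕ, 1 ≤ N → (N : ℝ) * m.toReal ≤ Cr * (N : ℝ) ^ θ := by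
      intro N hN
      have hN0 : (0 : ℝ) < N := by exact_mod_cast hN
      have hN1 : (1 : ℝ) ≤ N := by exact_mod_cast hN
      have h := hcount N
      have h2 : ((N : ℝ≥0∞) * m).toReal ≤ (C * ENNReal.ofReal (((2 * N + 1) * R) ^ θ)).toReal :=
        ENNReal.toReal_mono (ENNReal.mul_ne_top hC ENNReal.ofReal_ne_top) h
      rw [ENNReal.toReal_mul, ENNReal.toReal_mul, ENNReal.toReal_natCast, ENNReal.toReal_ofReal (by positivity)] at h2
      refine h2.trans ?_
      rw [hCr, mul_assoc, ← Real.mul_rpow (by positivity) hN0.le]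
      refine mul_le_mul_of_nonneg_left (Real.rpow_le_rpow (by positivity) (by nlinarith [hN1, hR0]) hθ0) ENNReal.toReal_nonneg
    -- `m.toReal ≤ Cr N^{θ−1} → 0`
    have hle : ∀ N : ℕ, 1 ≤ N → m.toReal ≤ Cr * (N : ℝ) ^ (θ - 1) := by
      intro N hN
      have hN0 : (0 : ℝ) < N := by exact_mod_cast hN
      have h := hreal N hN
      rw [Real.rpow_sub hN0, Real.rpow_one, mul_div_assoc']
      rw [le_div_iff₀ hN0]
      linarith
    have hlim : Tendsto (fun N : ℕ => Cr * (N : ℝ) ^ (θ - 1)) atTop (𝓝 (Cr * 0)) := by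
      refine Tendsto.const_mul Cr ?_
      have h1 : Tendsto (fun y : ℝ => y ^ (θ - 1)) atTop (𝓝 0) := by
        have := tendsto_rpow_neg_atTop (y := 1 - θ) (by linarith)
        simpa [show -(1 - θ) = θ - 1 by ring] using this
      exact h1.comp tendsto_natCast_atTop_atTop
    rw [mul_zero] at hlim
    have hle' : m.toReal ≤ 0 :=
      ge_of_tendsto hlim (Filter.eventually_atTop.2 ⟨1, fun N hN => hle N hN⟩)
    linarith
  -- conclude on every ball, hence a.e.
  have hball : ∀ n : ℕ, ∀ᵐ z ∂(volume.restrict (ball (0 : EuclideanSpace ℝ (Fin 3)) ((n : ℝ) + 1))), U z = 0 := by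
    intro n
    have h0 := hmass ((n : ℝ) + 1) (by linarith [n.cast_nonneg (α := ℝ)])
    have hae := (lintegral_eq_zero_iff' (hUm.restrict.enorm.pow_const 2)).1 h0
    filter_upwards [hae] with z hz
    simp only [Pi.zero_apply, ne_eq, OfNat.ofNat_ne_zero, not_false_eq_true, pow_eq_zero_iff, enorm_eq_zero] at hz
    exact hz
  have hU : (univ : Set (EuclideanSpace ℝ (Fin 3))) = ⋃ n : ℕ, ball (0 : EuclideanSpace ℝ (Fin 3)) ((n : ℝ) + 1) := by
    ext z
    simp only [mem_univ, mem_iUnion, mem_ball, dist_zero_right, true_iff]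
    obtain ⟨n, hn⟩ := exists_nat_gt ‖z‖
    exact ⟨n, by linarith⟩
  have h : ∀ᵐ z ∂(volume.restrict (univ : Set (EuclideanSpace ℝ (Fin 3)))), U z = 0 := by
    rw [hU, ae_restrict_iUnion_iff]
    exact hball
  rwa [Measure.restrict_univ] at h

end GalileanFrames

end Summit.NavierStokesRegularity.NavierStokesRegularity.Theorems.PowerGaugeEulerLiouville
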